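import Summits.CriticalPhenomena.PercolationContinuityZ3.Theorems.PercLowPointHalfSpaceQuantitativeBGNWallTwoGhostCS
import Summits.CriticalPhenomena.PercolationContinuityZ3.Theorems.PercLowPointHalfSpaceQuantitativeBGNWallBootstrap
import Mathlib.Analysis.SpecialFunctions.Pow.Real
import HarnessLib

/-!
# `QuantitativeBGN` (stmt-CriticalPhenomena-0913), line `longrange-wall-ghost-bootstrap` — K1, the basic wall two-ghost inequality

Last part of the stub `stub_wallTwoGhost` of the skeleton
`Cruxes/QuantitativeBGN/Lines/longrange_wall_ghost_bootstrap.lean` (objects in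
`Theorems/PercLowPointHalfSpaceQuantitativeBGNWallDefs.lean`, namespace `…Theorems.WallGhost`): the BASIC
(`θ = 0`) quadratic two-ghost inequality on the wall of the augmented model `augWall p λ α`,

  `Σ_{x∈s} (q_x/(1-q_x)) P(S'_{x,n})² ≤ C(λ)/n`,   `C(λ) = 128 e^{λ}`,

for every `α > 0`, `λ > 0`, bulk density `p`, `n ≥ 1` and finite set `s` of long wall-bond types at `0`
(`S'_{x,n}` = `wallTwoArm x n`: `0 ↮_H x`, both footprints `≥ n`, `C_H(0)` finite; `q_x = wallBondProb`).
This is Hutchcroft's two-ghost inequality (Ann. Probab. 48 (2020), arXiv:1808.08940, §3: Lemma 3.1, proof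
of Thm. 1.6, Cor. 1.7; tree template `Literature/Probability/Percolation/TwoGhostInequalityProofs.lean`)
re-proved with `G = H +` wall bonds, the group `ℤ²` of wall translations, the ghost weight on the
footprint, and martingale increments on wall bonds only (parts `…WallTwoGhost{Basics,Graph,Explore,
Kappa,Moment,Fatou,AKN,MTP,CS}.lean`). This file: Step 5 (removing the weights on `S'_{x,n}`:
`w(n)² P(S') ≤ E[Tgt]`, `w(n) ≥ 1/2`), Step 6 (assembly `Σ c_x q_x P(S'_x) ≤ 4 √(8 V_c/n)`, the choice
`c_x = P(S'_{x,n})` giving `Σ q P² ≤ 128/n`), and `q_x/(1-q_x) ≤ e^{λ} q_x` (`‖x‖ ≥ 1`).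
-/

noncomputable section

namespace Summit.CriticalPhenomena.PercolationContinuityZ3.Theorems

open MeasureTheory Filter Literature.Probability.Percolation Literature.Probability.LatticeModels
open Summit.CriticalPhenomena.PercolationContinuityZ3.Theorems.WallGhost
open scoped ENNReal

namespace WallTwoGhost
section Final

open TwoGhost

variable (p : unitInterval) (lam α : ℝ)

/-! ### Step 5: removing the weights on the wall two-arm event (proof of Cor. 1.7) -/

/-- The wall two-arm event is measurable. [folklore] -/
theorem measurableSet_wallTwoArm (x : Site 3) (n : ℕ) : MeasurableSet (wallTwoArm x n) := by
  have : wallTwoArm x n = (openConnIn {y : Site 3 | 0 ≤ y 0} 0 x)ᶜ ∩ (footGe 0 n ∩ (footGe x n ∩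
      {ω : BondConfig (Site 3) | (clusterH ω 0).Finite})) := by
    ext ω; simp [wallTwoArm, footGe]
  rw [this]
  exact (measurableSet_openConnIn_of_countable _ 0 x).compl.inter ((WallBootstrap.measurableSet_footGe 0 n).inter
    ((WallBootstrap.measurableSet_footGe x n).inter (measurableSet_finite_clusterH 0)))

/-- On a footprint `≥ n`, the weight is at least `w(n)`. [folklore] -/
theorem ofReal_wt_le_WfinH {n : ℕ} {ω : BondConfig (Site 3)} {x : Site 3} (h : (n : ℕ∞) ≤ footAt ω x) :
    ENNReal.ofReal (wt n n) ≤ WfinH n ω x := by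
  by_cases hf : (clusterH ω x).Finite
  · rw [WfinH_of_finite hf]
    refine ENNReal.ofReal_le_ofReal (wt_mono n ?_)
    rw [footAt_eq_footN hf, Nat.cast_le] at h
    exact h
  · rw [WfinH_of_infinite hf]
    exact ENNReal.ofReal_le_one.2 (wt_le_one _ _)

/-- **Removing the weights**: `w(n)² P(S'_{x,n}) ≤ E[Tgt_x]` for a long wall bond `{0, x}`.
[cite: Hutchcroft2020Locality, Cor. 1.7 (proof, §3 p. 9)] -/
theorem sq_mul_measure_wallTwoArm_le (n : ℕ) {x : Site 3} (hx0 : x 0 = 0) (hx : x ≠ 0) :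
    ENNReal.ofReal (wt n n) ^ 2 * augWall p lam α (wallTwoArm x n) ≤ ∫⁻ ω, Tgt n x ω ∂(augWall p lam α) := by
  rw [← lintegral_indicator_const (measurableSet_wallTwoArm x n)]
  refine lintegral_mono fun ω => ?_
  by_cases hω : ω ∈ wallTwoArm x n
  · rw [Set.indicator_of_mem hω]
    obtain ⟨h1, h2, h3, h4⟩ := hω
    have hxC : x ∉ clusterH ω 0 := h1
    have hxH : 0 ≤ x 0 := le_of_eq hx0.symm
    have he : s((0 : Site 3), x) ∉ ω := fun he =>
      hxC (by rw [← clusterH_eq_of_mk_mem le_rfl hxH hx.symm he]; exact self_mem_clusterH hxH ω)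
    rw [Tgt, ind_of_mem (show ω ∈ {ω | s((0 : Site 3), x) ∉ ω} from he),
      ind_of_mem (show ω ∈ {ω | x ∉ clusterH ω 0} from hxC), one_mul, one_mul, sq, WfH_of_finite h4]
    refine mul_le_mul' ?_ (ofReal_wt_le_WfinH h3)
    have := ofReal_wt_le_WfinH (n := n) h2
    rwa [WfinH_of_finite h4] at this
  · rw [Set.indicator_of_notMem hω]; exact bot_le

/-! ### Step 6: assembly and the quadratic form -/

/-- `w(n)² Σ_{x∈s} c_x q_x P(S'_{x,n}) ≤ √(8 V_c / n)` (Steps 1–5 in `ℝ≥0∞`). [folklore] -/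
theorem weighted_sum_le_ennreal {n : ℕ} (hn : 1 ≤ n) {c : Site 3 → ℝ} {s : Finset (Site 3)}
    (hs : ∀ x ∈ s, x 0 = 0 ∧ x ≠ 0) (hc : ∀ x ∈ s, 0 ≤ c x) (hq : ∀ x ∈ s, 0 < wallBondProb p lam α x) :
    ENNReal.ofReal (wt n n) ^ 2 * ∑ x ∈ s, ENNReal.ofReal (c x * wallBondProb p lam α x) * augWall p lam α (wallTwoArm x n) ≤
      ENNReal.ofReal (Real.sqrt (8 * Vc p lam α c s / n)) := by
  set P := augWall p lam α with hP
  have hF4 : ∫⁻ ω, F4 p lam α n c s ω ∂P ≤ ENNReal.ofReal (Real.sqrt (8 * Vc p lam α c s / n)) := by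
    have h := lintegral_F4_sq_le p lam α hn hs hc
    rw [← Real.sq_sqrt (show (0 : ℝ) ≤ 8 * Vc p lam α c s / n by
        exact div_nonneg (mul_nonneg (by norm_num) (Vc_nonneg p lam α c s)) (Nat.cast_nonneg _)),
      ENNReal.ofReal_pow (Real.sqrt_nonneg _)] at h
    exact (ENNReal.pow_le_pow_left_iff two_ne_zero).1 h
  calc ENNReal.ofReal (wt n n) ^ 2 * ∑ x ∈ s, ENNReal.ofReal (c x * wallBondProb p lam α x) * P (wallTwoArm x n)
      = ∑ x ∈ s, ENNReal.ofReal (c x * wallBondProb p lam α x) * (ENNReal.ofReal (wt n n) ^ 2 * P (wallTwoArm x n)) := by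
        rw [Finset.mul_sum]
        exact Finset.sum_congr rfl fun x _ => by ring
    _ ≤ ∑ x ∈ s, ENNReal.ofReal (c x * wallBondProb p lam α x) * ∫⁻ ω, Tgt n x ω ∂P :=
        Finset.sum_le_sum fun x hx => mul_le_mul' le_rfl (sq_mul_measure_wallTwoArm_le p lam α n (hs x hx).1 (hs x hx).2)
    _ ≤ ∫⁻ ω, VwH n ω 0 * ENNReal.ofReal |Zc p lam α c s ω| ∂P := sum_lintegral_Tgt_le p lam α n hs hc hq
    _ ≤ ∫⁻ ω, F4 p lam α n c s ω ∂P := lintegral_mono fun ω => Mabs_le p lam α hn c s ω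
    _ ≤ _ := hF4

/-- **`Σ_{x∈s} c_x q_x P(S'_{x,n}) ≤ 4 √(8 V_c / n)`** for nonnegative weights `c` on long wall-bond
types `s` (`w(n) ≥ 1/2`). [cite: Hutchcroft2020Locality, Cor. 1.7 (proof, §3 p. 9)] -/
theorem weighted_sum_le {n : ℕ} (hn : 1 ≤ n) {c : Site 3 → ℝ} {s : Finset (Site 3)}
    (hs : ∀ x ∈ s, x 0 = 0 ∧ x ≠ 0) (hc : ∀ x ∈ s, 0 ≤ c x) (hq : ∀ x ∈ s, 0 < wallBondProb p lam α x) :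
    ∑ x ∈ s, c x * wallBondProb p lam α x * (augWall p lam α).real (wallTwoArm x n) ≤
      4 * Real.sqrt (8 * Vc p lam α c s / n) := by
  set P := augWall p lam α with hP
  have h := weighted_sum_le_ennreal p lam α hn hs hc hq
  have hfin : ∑ x ∈ s, ENNReal.ofReal (c x * wallBondProb p lam α x) * P (wallTwoArm x n) ≠ ∞ :=
    ENNReal.sum_ne_top.2 fun x _ => ENNReal.mul_ne_top ENNReal.ofReal_ne_top (measure_ne_top P _)
  have hw0 : 0 ≤ wt n n := wt_nonneg n n
  have hreal := ENNReal.toReal_mono ENNReal.ofReal_ne_top h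
  rw [ENNReal.toReal_mul, ENNReal.toReal_pow, ENNReal.toReal_ofReal hw0, ENNReal.toReal_ofReal (Real.sqrt_nonneg _),
    ENNReal.toReal_sum fun x _ => ENNReal.mul_ne_top ENNReal.ofReal_ne_top (measure_ne_top P _)] at hreal
  have hS : ∑ x ∈ s, (ENNReal.ofReal (c x * wallBondProb p lam α x) * P (wallTwoArm x n)).toReal =
      ∑ x ∈ s, c x * wallBondProb p lam α x * P.real (wallTwoArm x n) := by
    refine Finset.sum_congr rfl fun x hx => ?_
    rw [ENNReal.toReal_mul, ENNReal.toReal_ofReal (mul_nonneg (hc x hx) (hq x hx).le), measureReal_def]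
  rw [hS] at hreal
  have hw : (1 / 2 : ℝ) ≤ wt n n := half_le_wt_self hn
  have hS0 : 0 ≤ ∑ x ∈ s, c x * wallBondProb p lam α x * P.real (wallTwoArm x n) :=
    Finset.sum_nonneg fun x hx => mul_nonneg (mul_nonneg (hc x hx) (hq x hx).le) measureReal_nonneg
  have hw2 : (1 / 4 : ℝ) ≤ wt n n ^ 2 := by nlinarith
  nlinarith [mul_le_mul_of_nonneg_right hw2 hS0, Real.sqrt_nonneg (8 * Vc p lam α c s / n)]

/-- **The quadratic form** (the choice `c_x = P(S'_{x,n})`): `Σ_{x∈s} q_x P(S'_{x,n})² ≤ 128/n`.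
[cite: Hutchcroft2020Locality, Cor. 1.7 (proof, §3 p. 9)] -/
theorem quadratic_bound {n : ℕ} (hn : 1 ≤ n) {s : Finset (Site 3)} (hs : ∀ x ∈ s, x 0 = 0 ∧ x ≠ 0)
    (hq : ∀ x ∈ s, 0 < wallBondProb p lam α x) :
    ∑ x ∈ s, wallBondProb p lam α x * (augWall p lam α).real (wallTwoArm x n) ^ 2 ≤ 128 / n := by
  set P := augWall p lam α with hP
  set c : Site 3 → ℝ := fun x => P.real (wallTwoArm x n) with hcdef
  have hc : ∀ x ∈ s, 0 ≤ c x := fun x _ => measureReal_nonneg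
  set S := ∑ x ∈ s, wallBondProb p lam α x * P.real (wallTwoArm x n) ^ 2 with hSdef
  have hV : Vc p lam α c s = S := by
    simp only [Vc, hSdef, hcdef]; exact Finset.sum_congr rfl fun x _ => by ring
  have hW : ∑ x ∈ s, c x * wallBondProb p lam α x * P.real (wallTwoArm x n) = S := by
    simp only [hSdef, hcdef]; exact Finset.sum_congr rfl fun x _ => by ring
  have h := weighted_sum_le p lam α hn hs hc hq
  rw [hW, hV] at h
  have hn0 : (0 : ℝ) < n := by exact_mod_cast hn
  have hS0 : 0 ≤ S := Finset.sum_nonneg fun x hx => mul_nonneg (hq x hx).le (sq_nonneg _)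
  by_cases hSpos : S = 0
  · rw [hSpos]; positivity
  · have hSp : 0 < S := lt_of_le_of_ne hS0 (Ne.symm hSpos)
    have hsq : S ^ 2 ≤ 16 * (8 * S / n) := by
      have h8 : (0 : ℝ) ≤ 8 * S / n := by positivity
      nlinarith [Real.sq_sqrt h8, Real.sqrt_nonneg (8 * S / n)]
    have : S * S ≤ (128 / n) * S := by rw [← sq]; convert hsq using 1; field_simp; ring
    exact le_of_mul_le_mul_right this hSp

/-! ### The bond probabilities of long wall bonds -/

/-- **`0 < q_x ≤ 1 - e^{-λ}`** for a long wall bond `{0, x}` (`λ > 0`, `α ≥ -2`, `‖x‖ ≥ 1`). [folklore] -/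
theorem wallBondProb_pos_and_le {lam α : ℝ} (hlam : 0 < lam) (hα : 0 ≤ 2 + α) {x : Site 3} (hx0 : x 0 = 0)
    (hx : x ≠ 0) (hadj : ¬ (zdGraph 3).Adj 0 x) :
    0 < wallBondProb p lam α x ∧ wallBondProb p lam α x ≤ 1 - Real.exp (-lam) := by
  rw [WallBootstrap.wallBondProb_eq p hlam.le α hx0 hx hadj]
  -- a nonzero integer vector has sup norm `≥ 1`
  have hn : 1 ≤ ‖x‖ := by
    obtain ⟨i, hi⟩ := Function.ne_iff.1 hx
    calc (1 : ℝ) ≤ ‖x i‖ := by rw [Int.norm_eq_abs]; exact_mod_cast Int.one_le_abs hi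
      _ ≤ ‖x‖ := norm_le_pi_norm x i
  have hr : ‖x‖ ^ (-(2 + α)) ≤ 1 := Real.rpow_le_one_of_one_le_of_nonpos hn (by linarith)
  have hr0 : 0 < ‖x‖ ^ (-(2 + α)) := Real.rpow_pos_of_pos (by linarith) _
  constructor
  · have : Real.exp (-(lam * ‖x‖ ^ (-(2 + α)))) < 1 := Real.exp_lt_one_iff.2 (by nlinarith)
    linarith
  · have : Real.exp (-lam) ≤ Real.exp (-(lam * ‖x‖ ^ (-(2 + α)))) := Real.exp_le_exp.2 (by nlinarith)
    linarith

/-- `q/(1-q) ≤ e^{λ} q` for the long wall bonds. [folklore] -/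
theorem div_one_sub_le {lam α : ℝ} (hlam : 0 < lam) (hα : 0 ≤ 2 + α) {x : Site 3} (hx0 : x 0 = 0) (hx : x ≠ 0)
    (hadj : ¬ (zdGraph 3).Adj 0 x) :
    wallBondProb p lam α x / (1 - wallBondProb p lam α x) ≤ Real.exp lam * wallBondProb p lam α x := by
  obtain ⟨hq0, hq1⟩ := wallBondProb_pos_and_le p hlam hα hx0 hx hadj
  have he : 0 < Real.exp (-lam) := Real.exp_pos _
  have h1 : Real.exp (-lam) ≤ 1 - wallBondProb p lam α x := by linarith
  rw [div_le_iff₀ (lt_of_lt_of_le he h1)]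
  calc wallBondProb p lam α x = Real.exp lam * wallBondProb p lam α x * Real.exp (-lam) := by
        rw [mul_assoc, mul_comm (wallBondProb p lam α x), ← mul_assoc, ← Real.exp_add, add_neg_cancel, Real.exp_zero, one_mul]
    _ ≤ Real.exp lam * wallBondProb p lam α x * (1 - wallBondProb p lam α x) :=
        mul_le_mul_of_nonneg_left h1 (mul_nonneg (Real.exp_pos _).le hq0.le)

end Final

end WallTwoGhost

open WallTwoGhost in
/-- **stub_wallTwoGhost (K1, basic form).** The basic (`θ = 0`) quadratic two-ghost inequality on the
wall of the augmented model `augWall p λ α` (bulk bond percolation on `ℤ³` of density `p` plus long wall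
bonds `{u,v}`, `u₀ = v₀ = 0`, of probability `1 - exp(-λ‖u-v‖^{-(2+α)})`): for every `α > 0`, `λ > 0`,
every `p`, `n ≥ 1` and finite set `s` of long wall-bond types at `0`,
`Σ_{x∈s} (q_x/(1-q_x)) P(S'_{x,n})² ≤ 128 e^{λ} / n`, where `S'_{x,n}` is the wall two-arm event
(`0 ↮_H x`, both wall footprints `≥ n`, `C_H(0)` finite). Proof: Hutchcroft's argument (Ann. Probab. 48
(2020), arXiv:1808.08940, §3) transplanted to the wall — the AKN exchange at the bond `{0,x}` with the
ghost field on the FOOTPRINT integrated out (`Tgt_add_le`, `lintegral_Tgt_add_le`), the mass-transport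
principle for the wall translations `ℤ²` with vertex density `w(F)/F` (`lintegral_stEv_NN_eq`,
`sum_lintegral_Tgt_le`), the exploration martingale with increments `κ(e)(ω_e - q_e)` on wall bonds only
and quadratic variation `≤ 4 F Σ_x c_x² q_x` (truncated step graphs + Fatou, `lintegral_Zc_sq_le`),
Cauchy–Schwarz and summation by parts (`lintegral_F4_sq_le`), removal of the weights on `S'_{x,n}`
(`sq_mul_measure_wallTwoArm_le`), the choice `c_x = P(S'_{x,n})`, and `q_x/(1-q_x) ≤ e^{λ} q_x`.
[cite: Hutchcroft2020Locality, §3 (Lemma 3.1, proof of Thm. 1.6, Cor. 1.7)] -/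
theorem stub_wallTwoGhost : ∀ α lam : ℝ, 0 < α → 0 < lam → ∃ C : ℝ, ∀ p : unitInterval, ∀ n : ℕ, 1 ≤ n → ∀ s : Finset WallIdx, ∑ x ∈ s, wallBondProb p lam α x.1 / (1 - wallBondProb p lam α x.1) * (augWall p lam α).real (wallTwoArm x.1 n) ^ 2 ≤ C * (n : ℝ)⁻¹ := by
  intro α lam hα hlam
  refine ⟨128 * Real.exp lam, fun p n hn s => ?_⟩
  classical
  have hα' : 0 ≤ 2 + α := by linarith
  set s' : Finset (Site 3) := s.image Subtype.val with hs'def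
  have hs' : ∀ y ∈ s', y 0 = 0 ∧ y ≠ 0 := by
    intro y hy
    obtain ⟨x, -, rfl⟩ := Finset.mem_image.1 hy
    exact ⟨x.2.1, x.2.2.1⟩
  have hq' : ∀ y ∈ s', 0 < wallBondProb p lam α y := by
    intro y hy
    obtain ⟨x, -, rfl⟩ := Finset.mem_image.1 hy
    exact (wallBondProb_pos_and_le p hlam hα' x.2.1 x.2.2.1 x.2.2.2).1
  have hinj : Set.InjOn (Subtype.val : WallIdx → Site 3) ↑s := Subtype.val_injective.injOn
  have hsum : ∑ x ∈ s, wallBondProb p lam α x.1 * (augWall p lam α).real (wallTwoArm x.1 n) ^ 2 =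
      ∑ y ∈ s', wallBondProb p lam α y * (augWall p lam α).real (wallTwoArm y n) ^ 2 := by
    rw [hs'def, Finset.sum_image hinj]
  calc ∑ x ∈ s, wallBondProb p lam α x.1 / (1 - wallBondProb p lam α x.1) * (augWall p lam α).real (wallTwoArm x.1 n) ^ 2
      ≤ ∑ x ∈ s, Real.exp lam * (wallBondProb p lam α x.1 * (augWall p lam α).real (wallTwoArm x.1 n) ^ 2) :=
        Finset.sum_le_sum fun x _ => by
          rw [← mul_assoc]
          exact mul_le_mul_of_nonneg_right (div_one_sub_le p hlam hα' x.2.1 x.2.2.1 x.2.2.2) (sq_nonneg _)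
    _ = Real.exp lam * ∑ y ∈ s', wallBondProb p lam α y * (augWall p lam α).real (wallTwoArm y n) ^ 2 := by
        rw [← Finset.mul_sum, hsum]
    _ ≤ Real.exp lam * (128 / n) := mul_le_mul_of_nonneg_left (quadratic_bound p lam α hn hs' hq') (Real.exp_pos _).le
    _ = 128 * Real.exp lam * (n : ℝ)⁻¹ := by ring

end Summit.CriticalPhenomena.PercolationContinuityZ3.Theorems
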